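import Summits.FinalStateConjecture.FinalStateConjecture.Theorems.ClusterCompletenessRecurrentlyFlatDispersesRestart
import Summits.FinalStateConjecture.FinalStateConjecture.Theorems.ClusterCompletenessRecurrentlyFlatDispersesStubFutureSet

/-!
# Crux `RecurrentlyFlatDisperses` (stmt-FinalStateConjecture-14665), line `Sketch` — SLAB FUTURE:
# the chronological future of a late slab is exactly the late region above it

Continuation lead c5, 2026-08-16 (brick on the `stub_decomp` side). For the crux's anchored flat
late chart `Ψ₀ : U₀ → 𝒟` of a maximal vacuum Cauchy development of admissible data (hypotheses =
the five anchored conjuncts of `Theses.ClusterCompleteness.RecurrentlyFlatDisperses`, verbatim)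
and every chart time `τ > τ₀`,
`I⁺(Ψ₀{x⁰ = τ}) = Ψ₀{x⁰ > τ}` (`chronologicalFuture_image_timeSlab`): the late slab `S_τ` generates
exactly the late region `W_τ` above it.

* `⊆` is the second conclusion of the landed `stub_futureSet` (its two arguments discharged by
  the landed `stub_anchorCone`, `stub_chartFuture`);
* `⊇` (`SlabFuture.image_lateRegion_subset_chronologicalFuture_image_timeSlab`): a late point
  `Ψ₀ x`, `x⁰ > τ`, is the endpoint of the chart-vertical future timelike curve from its slab foot
  `Ψ₀(x − (x⁰ − τ)∂₀)` (the foot lies in `U₀ ⊇ {x⁰ > τ₀}` because `τ > τ₀`), i.e. the landed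
  `Restart.mem_chronologicalFuture_of_eq_add_smul` with `s = x⁰ − τ > 0`.

Mathlib + the Statement cone + landed bricks only; no definitions, no named facts.
-/

noncomputable section

open scoped Manifold ContDiff Topology
open Bundle Filter Set Function TopologicalSpace Literature.Geometry.Lorentzian

namespace Summit.FinalStateConjecture.FinalStateConjecture.Theorems.RecurrentlyFlatDisperses

namespace SlabFuture

/-- **The late region above a slab lies in the chronological future of the slab.** Let
`Ψ₀ : U₀ → 𝓢` be a smooth chart map on an open `U₀ ⊇ {x⁰ > τ₀}` of `E4` whose vertical
differential `dΨ₀(∂₀)` is uniformly timelike, `g(dΨ₀ ∂₀, dΨ₀ ∂₀) ≤ -3/4`, and future-directed at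
every late point. Then for every `τ > τ₀`, `Ψ₀{x⁰ > τ} ⊆ I⁺(Ψ₀{x⁰ = τ})`: the late point `Ψ₀ x`,
`x⁰ > τ`, is reached from its slab foot `Ψ₀(x − (x⁰ − τ)∂₀)` by the chart-vertical future
timelike curve (`Restart.mem_chronologicalFuture_of_eq_add_smul`; O'Neill 1983, Ch. 14, p. 402). -/
theorem image_lateRegion_subset_chronologicalFuture_image_timeSlab {𝓢 : Spacetime 4}
    {U₀ : Opens E4} {Ψ₀ : U₀ → 𝓢.carrier} {τ₀ : ℝ} (hΨs : ContMDiff 𝓘(ℝ, E4) (𝓡 4) ∞ Ψ₀)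
    (hU : {x : E4 | τ₀ < x 0} ⊆ (U₀ : Set E4))
    (hvert : ∀ y : U₀, τ₀ < y.1 0 →
      𝓢.metric.val (Ψ₀ y) (mfderiv 𝓘(ℝ, E4) (𝓡 4) Ψ₀ y (E4.basisVector 0))
          (mfderiv 𝓘(ℝ, E4) (𝓡 4) Ψ₀ y (E4.basisVector 0)) ≤ -(3 / 4) ∧
        𝓢.timeOrientation.IsFutureDirected (mfderiv 𝓘(ℝ, E4) (𝓡 4) Ψ₀ y (E4.basisVector 0)))
    {τ : ℝ} (hτ : τ₀ < τ) :
    Ψ₀ '' (Minkowski.backgroundOn U₀).lateRegion τ ⊆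
      𝓢.metric.chronologicalFuture 𝓢.timeOrientation
        (Ψ₀ '' (Minkowski.backgroundOn U₀).timeSlab τ) := by
  rintro q ⟨x, hx, rfl⟩
  have hxτ : τ < x.1 0 := hx
  -- the slab foot `z = x - (x⁰ - τ) ∂₀` of `x`: `z⁰ = τ > τ₀`
  set s : ℝ := x.1 0 - τ with hs_def
  have hs : 0 < s := sub_pos.mpr hxτ
  have he : (E4.basisVector 0 : E4) 0 = 1 := by simp [E4.basisVector]
  have hz0 : (x.1 - s • (E4.basisVector 0 : E4)) 0 = τ := by
    rw [PiLp.sub_apply, PiLp.smul_apply, he, smul_eq_mul, mul_one, hs_def]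
    ring
  have hzlate : τ₀ < (x.1 - s • (E4.basisVector 0 : E4)) 0 := by
    rw [hz0]
    exact hτ
  set z : U₀ := ⟨x.1 - s • (E4.basisVector 0 : E4), hU hzlate⟩ with hz
  have hzslab : z ∈ (Minkowski.backgroundOn U₀).timeSlab τ := hz0
  have hz₀ : τ₀ < z.1 0 := hzlate
  have hxz : (x : E4) = z.1 + s • (E4.basisVector 0 : E4) := (sub_add_cancel _ _).symm
  have hfut : Ψ₀ x ∈ 𝓢.metric.chronologicalFuture 𝓢.timeOrientation {Ψ₀ z} :=
    Restart.mem_chronologicalFuture_of_eq_add_smul hΨs hU hvert z x hz₀ hs hxz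
  exact LorentzianMetric.chronologicalFuture_mono
    (singleton_subset_iff.mpr (mem_image_of_mem Ψ₀ hzslab)) hfut

end SlabFuture

/-- **The chronological future of a late slab is the late region above it** (crux
stmt-FinalStateConjecture-14665, line `Sketch`; hypotheses = the crux's anchored conjuncts
verbatim). If `Ψ₀ : U₀ → 𝒟` is an anchored flat late chart after time `τ₀` for the region
`O = exteriorOf 𝒟 (Ψ₀{x⁰ > τ₀})` of a maximal vacuum Cauchy development of admissible data, then
for every `τ > τ₀`, `I⁺(Ψ₀{x⁰ = τ}) = Ψ₀{x⁰ > τ}`. `⊆`: the landed `stub_futureSet` (second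
conclusion, with `stub_anchorCone`, `stub_chartFuture`); `⊇`: the chart verticals from the slab
feet (`SlabFuture.image_lateRegion_subset_chronologicalFuture_image_timeSlab`, cone bound
`FutureSet.val_mfderiv_basisVector_zero_le`). O'Neill 1983, Ch. 14, p. 402. -/
theorem chronologicalFuture_image_timeSlab :
    ∀ (X : Type) [TopologicalSpace X] [ChartedSpace E3 X] [IsManifold (𝓡 3) ∞ X] [T2Space X]
      [SecondCountableTopology X] [ConnectedSpace X],
      ∀ D ∈ admissibleVacuumData X, ∀ 𝒟 : VacuumCauchyDevelopment D, 𝒟.IsMaximal →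
        ∀ (O : Set 𝒟.carrier) (τ₀ : ℝ) (U₀ : Opens E4) (Ψ₀ : U₀ → 𝒟.carrier),
          (𝒟.toSpacetime.IsLateChart (Minkowski.backgroundOn U₀) O τ₀ Ψ₀ ∧
            {x : E4 | τ₀ < x 0} ⊆ (U₀ : Set E4) ∧
            O = Summit.FinalStateConjecture.exteriorOf 𝒟.toCauchyDevelopment
              (Ψ₀ '' (Minkowski.backgroundOn U₀).lateRegion τ₀) ∧
            (∀ τ₁ : ℝ, τ₀ < τ₁ → O \ Ψ₀ '' (Minkowski.backgroundOn U₀).lateRegion τ₁ ⊆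
              𝒟.metric.causalPast 𝒟.timeOrientation
                (Ψ₀ '' (Minkowski.backgroundOn U₀).timeSlab τ₁)) ∧
            (∀ τ : ℝ, τ₀ < τ → 𝒟.toSpacetime.deviationCk (Minkowski.backgroundOn U₀) Ψ₀ 0 τ ≤
              ENNReal.ofReal (1 / 4))) →
          ∀ τ : ℝ, τ₀ < τ →
            𝒟.metric.chronologicalFuture 𝒟.timeOrientation
                (Ψ₀ '' (Minkowski.backgroundOn U₀).timeSlab τ) =
              Ψ₀ '' (Minkowski.backgroundOn U₀).lateRegion τ := by
  intro X _ _ _ _ _ _ D hD 𝒟 hmax O τ₀ U₀ Ψ₀ hyp τ hτ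
  -- the landed neighbours: pointwise anchor, orientation of chart time, future-set property
  have hA := stub_anchorCone
  have hT := stub_chartFuture hA
  have hF := (stub_futureSet hA hT X D hD 𝒟 hmax O τ₀ U₀ Ψ₀ hyp).2 τ hτ
  have hdev : ∀ y : U₀, τ₀ < y.1 0 →
      ‖𝒟.toSpacetime.deviation (Minkowski.backgroundOn U₀) Ψ₀ y‖ ≤ 1 / 4 :=
    hA X D hD 𝒟 hmax O τ₀ U₀ Ψ₀ hyp
  have hfut : ∀ y : U₀, τ₀ < y.1 0 →
      𝒟.timeOrientation.IsFutureDirected (mfderiv 𝓘(ℝ, E4) (𝓡 4) Ψ₀ y (E4.basisVector 0)) :=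
    hT X D hD 𝒟 hmax O τ₀ U₀ Ψ₀ hyp
  obtain ⟨hchart, hU, -, -, -⟩ := hyp
  have hvert : ∀ y : U₀, τ₀ < y.1 0 →
      𝒟.metric.val (Ψ₀ y) (mfderiv 𝓘(ℝ, E4) (𝓡 4) Ψ₀ y (E4.basisVector 0))
          (mfderiv 𝓘(ℝ, E4) (𝓡 4) Ψ₀ y (E4.basisVector 0)) ≤ -(3 / 4) ∧
        𝒟.timeOrientation.IsFutureDirected (mfderiv 𝓘(ℝ, E4) (𝓡 4) Ψ₀ y (E4.basisVector 0)) :=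
    fun y hy ↦ ⟨FutureSet.val_mfderiv_basisVector_zero_le Ψ₀ y (hdev y hy), hfut y hy⟩
  exact hF.antisymm (SlabFuture.image_lateRegion_subset_chronologicalFuture_image_timeSlab
    (𝓢 := 𝒟.toSpacetime) hchart.contMDiff hU hvert hτ)

end Summit.FinalStateConjecture.FinalStateConjecture.Theorems.RecurrentlyFlatDisperses

end
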